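import Summits.HodgeConjecture.HodgeConjecture.Theorems.R90S6GLCosetLatticeDict    -- W7-f (i): `latt_eq_latt_iff_mem_glInt`, `isLattice_latt`, `exists_eq_latt_of_isLattice`
import HarnessLib

/-!
# R90 · S6 «Ch. 14.1–14.5 stable TF» — WAVE 7 card W7-f (iii): THE EQUIVARIANT BIJECTION `GL_N(K) ∕ GL_N(𝒪) ≃ {𝒪-lattices of K^N}`, `gK ↦ g·𝒪^N`
# (`Theorems/R90S6GLCosetLattice.lean`)

Cell `hodgecm-mathlib`, crux H413 (`stmt-HodgeConjecture-24833`), route `HCCMUnconditional`; programme R90-TF, section S6 (base `R90-C14`, dealer R90-C14-plan (g2)),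
seat R90-C14-p10 (g0); card **W7-f** `glCoset_equiv_lattice` (menu `R90/R90-szE1.1/g3/CLOSURE-E1.1.md` §3, DAG row E1.4.3.1.1).  Lane `--kind definition --supports
stmt-HodgeConjecture-24833` (helper: TWO DEFINITIONS — the bijections, which the card names — with their laws; no instance, no notation, no named fact, no `sorry`).
Imports: ★ `Theorems.R90S6GLCosetLatticeDict` (W7-f (i), the theorems this packages) + HarnessLib; no `Cruxes` import.

THE MATHEMATICS (Serre, *Trees* II.1.1; Macdonald V §2 «`G ∕ K` may be identified with the set of lattices in `V`», `x ↦ Lx`).  By W7-f (i): `g·𝒪^N = g′·𝒪^N ⟺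
g⁻¹g′ ∈ GL_N(𝒪)` (`latt_eq_latt_iff_mem_glInt`), so `gK ↦ latt g` is a well-defined injection of `GL_N(K) ⧸ glInt N K` into the `𝒪`-submodules of `K^N`; its image is
the set of FRAMED lattices `{latt g}` — which, for `𝒪` a principal ideal ring (a DVR, e.g. `K = L_w`), is exactly Mathlib's `Submodule.IsLattice` submodules
(`exists_eq_latt_iff_isLattice`).  This file packages the two bijections as `Equiv`s and records their defining law and `GL_N(K)`-equivariance
(`γ • gK ↦ γ·(g·𝒪^N) = mapGL γ (latt g)`, Mathlib's `MulAction` on `G ⧸ K` vs ★ T1a's `mapGL`):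
* §1 **`glCosetEquivLatt : GL (Fin N) K ⧸ glInt N K ≃ {M // ∃ g, M = latt g}`**, `glCosetEquivLatt_apply_coe` (value on `gK` is `latt g`), `glCosetEquivLatt_smul`
  (equivariance), `glCosetEquivLatt_symm_apply_latt` (the inverse sends `latt g` to `gK`);
* §2 **`glCosetEquivIsLattice : GL (Fin N) K ⧸ glInt N K ≃ {M // M.IsLattice K}`** (`𝒪` principal), `glCosetEquivIsLattice_apply_coe`, `glCosetEquivIsLattice_smul`.
WHY ON PATH: E1.4.3.1 (vertex model of `GL₃(L_w) ∕ K_E`, twisted polarity `P_δ` on lattices) and E1.4.4.2.2 count `K_E`-cosets in a double coset as lattices in a given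
relative position (`R90S6GLCosetInvariants`); an `Equiv` is what turns `Set.ncard` ∕ `Finset.sum` over `G ⧸ K` into sums over lattices.
HONEST LABEL: packaging of W7-f (i); proves no printed global statement, discharges no citation; count-neutral helper until E1.4.3.1 ∕ E1.4.4.2.2 consume it.
HC_CM is proved only modulo the 7 printed citations (2 remaining named inputs: hLiu418 = stmt-HodgeConjecture-24832, h413 = stmt-HodgeConjecture-24833) until rung 0 closes.

## References
* [Serre1980Trees] J.-P. Serre, *Trees* (1980), Ch. II §1.1 (`GL(V) ∕ GL(L)` = lattices; the action on lattices).
* [Macdonald1995] I. G. Macdonald, *Symmetric Functions and Hall Polynomials*, 2nd ed. (1995), Ch. V §2 (PDF p. 246: «`G ∕ K` may be identified with the set of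
  lattices in `V`»).
-/
set_option autoImplicit false
-- the mandated namespace repeats the single-problem summit's segment (`HodgeConjecture.HodgeConjecture`)
set_option linter.dupNamespace false

noncomputable section

open scoped Valued WithZero Matrix MatrixGroups
open Literature.NumberTheory.Automorphic Literature.NumberTheory.Automorphic.HermitianLattice Literature.NumberTheory.Automorphic.UnitaryLatticeTree

namespace Summit.HodgeConjecture.HodgeConjecture.R90.S6

variable {K : Type*} [Field K] [Valued K ℤᵐ⁰] [ValuativeRel K] [(Valued.v : Valuation K ℤᵐ⁰).Compatible] {N : ℕ}

/-! ## §1 `GL_N(K) ∕ GL_N(𝒪) ≃` framed lattices `{g·𝒪^N}` -/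

/-- **`GL_N(K) ∕ GL_N(𝒪) ≃ {g·𝒪^N : g ∈ GL_N(K)}`, `gK ↦ g·𝒪^N`** — well defined and injective by W7-f (i) `latt_eq_latt_iff_mem_glInt` (`g·𝒪^N = g′·𝒪^N ⟺ g⁻¹g′ ∈
GL_N(𝒪)`), surjective by construction of the target; the inverse picks any frame of the lattice. [cite: Serre1980Trees, II.1.1] [cite: Macdonald1995, Ch. V §2 (PDF p. 246)] -/
def glCosetEquivLatt :
    GL (Fin N) K ⧸ glInt N K ≃ {M : Submodule 𝒪[K] (Fin N → K) // ∃ g : GL (Fin N) K, M = latt (g : Matrix (Fin N) (Fin N) K)} where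
  toFun q := Quotient.liftOn' q (fun g => ⟨latt (g : Matrix (Fin N) (Fin N) K), g, rfl⟩)
    (fun g g' h => Subtype.ext ((latt_eq_latt_iff_mem_glInt g g').2 (QuotientGroup.leftRel_apply.1 h)))
  invFun M := (M.2.choose : GL (Fin N) K ⧸ glInt N K)
  left_inv q := Quotient.inductionOn' q fun g => by
    have h := (⟨latt (g : Matrix (Fin N) (Fin N) K), g, rfl⟩ :
      {M : Submodule 𝒪[K] (Fin N → K) // ∃ g : GL (Fin N) K, M = latt (g : Matrix (Fin N) (Fin N) K)}).2.choose_spec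
    exact ((latt_eq_latt_iff_quotient_eq _ _).1 h).symm
  right_inv M := by
    apply Subtype.ext
    change latt ((M.2.choose : GL (Fin N) K) : Matrix (Fin N) (Fin N) K) = M.1
    exact M.2.choose_spec.symm

/-- The defining law: **`glCosetEquivLatt (gK) = g·𝒪^N`**. [cite: Serre1980Trees, II.1.1] -/
theorem glCosetEquivLatt_apply_coe (g : GL (Fin N) K) :
    ((glCosetEquivLatt (g : GL (Fin N) K ⧸ glInt N K) : {M : Submodule 𝒪[K] (Fin N → K) // ∃ g : GL (Fin N) K, M = latt (g : Matrix (Fin N) (Fin N) K)}) :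
        Submodule 𝒪[K] (Fin N → K)) = latt (g : Matrix (Fin N) (Fin N) K) :=
  rfl

/-- The inverse law: **`glCosetEquivLatt⁻¹ (g·𝒪^N) = gK`**. [cite: Serre1980Trees, II.1.1] -/
theorem glCosetEquivLatt_symm_apply_latt (g : GL (Fin N) K) :
    glCosetEquivLatt.symm ⟨latt (g : Matrix (Fin N) (Fin N) K), g, rfl⟩ = (g : GL (Fin N) K ⧸ glInt N K) := by
  rw [Equiv.symm_apply_eq]
  exact Subtype.ext (glCosetEquivLatt_apply_coe g).symm

/-- **`GL_N(K)`-EQUIVARIANCE: `glCosetEquivLatt (γ • q) = γ · glCosetEquivLatt q`** (Mathlib's left action `γ • gK = (γg)K` on `G ⧸ K` versus ★ T1a's `mapGL γ` on lattices,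
★ `mapGL_latt`). [cite: Serre1980Trees, II.1.1] -/
theorem glCosetEquivLatt_smul (γ : GL (Fin N) K) (q : GL (Fin N) K ⧸ glInt N K) :
    ((glCosetEquivLatt (γ • q) : {M : Submodule 𝒪[K] (Fin N → K) // ∃ g : GL (Fin N) K, M = latt (g : Matrix (Fin N) (Fin N) K)}) : Submodule 𝒪[K] (Fin N → K)) =
      mapGL γ ((glCosetEquivLatt q : {M : Submodule 𝒪[K] (Fin N → K) // ∃ g : GL (Fin N) K, M = latt (g : Matrix (Fin N) (Fin N) K)}) :
        Submodule 𝒪[K] (Fin N → K)) := by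
  induction q using QuotientGroup.induction_on with
  | H g => rw [MulAction.Quotient.smul_coe, smul_eq_mul, glCosetEquivLatt_apply_coe, glCosetEquivLatt_apply_coe, mapGL_latt]

/-! ## §2 `GL_N(K) ∕ GL_N(𝒪) ≃` Mathlib's `𝒪`-lattices (`𝒪` principal) -/

/-- **`GL_N(K) ∕ GL_N(𝒪) ≃ {𝒪-lattices of K^N}`, `gK ↦ g·𝒪^N`**, onto Mathlib's intrinsic `Submodule.IsLattice` (finitely generated `𝒪`-submodules spanning `K^N`), for
`𝒪 = 𝒪[K]` a principal ideal ring (a DVR, e.g. `K = L_w`): `glCosetEquivLatt` followed by W7-f (i) `exists_eq_latt_iff_isLattice`.  This is the card's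
`glCoset_equiv_lattice`. [cite: Macdonald1995, Ch. V §2 (PDF p. 246)] [cite: Serre1980Trees, II.1.1] -/
def glCosetEquivIsLattice [IsPrincipalIdealRing 𝒪[K]] :
    GL (Fin N) K ⧸ glInt N K ≃ {M : Submodule 𝒪[K] (Fin N → K) // M.IsLattice K} :=
  glCosetEquivLatt.trans (Equiv.subtypeEquivRight fun M => exists_eq_latt_iff_isLattice M)

/-- The defining law: **`glCosetEquivIsLattice (gK) = g·𝒪^N`**. [cite: Serre1980Trees, II.1.1] -/
theorem glCosetEquivIsLattice_apply_coe [IsPrincipalIdealRing 𝒪[K]] (g : GL (Fin N) K) :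
    ((glCosetEquivIsLattice (g : GL (Fin N) K ⧸ glInt N K) : {M : Submodule 𝒪[K] (Fin N → K) // M.IsLattice K}) : Submodule 𝒪[K] (Fin N → K)) =
      latt (g : Matrix (Fin N) (Fin N) K) :=
  rfl

/-- **`GL_N(K)`-equivariance of `glCosetEquivIsLattice`**: `glCosetEquivIsLattice (γ • q) = γ · glCosetEquivIsLattice q`. [cite: Serre1980Trees, II.1.1] -/
theorem glCosetEquivIsLattice_smul [IsPrincipalIdealRing 𝒪[K]] (γ : GL (Fin N) K) (q : GL (Fin N) K ⧸ glInt N K) :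
    ((glCosetEquivIsLattice (γ • q) : {M : Submodule 𝒪[K] (Fin N → K) // M.IsLattice K}) : Submodule 𝒪[K] (Fin N → K)) =
      mapGL γ ((glCosetEquivIsLattice q : {M : Submodule 𝒪[K] (Fin N → K) // M.IsLattice K}) : Submodule 𝒪[K] (Fin N → K)) := by
  induction q using QuotientGroup.induction_on with
  | H g => rw [MulAction.Quotient.smul_coe, smul_eq_mul, glCosetEquivIsLattice_apply_coe, glCosetEquivIsLattice_apply_coe, mapGL_latt]

end Summit.HodgeConjecture.HodgeConjecture.R90.S6

end
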